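import Literature.Topology.FourManifolds.LefschetzBaseCover
import Literature.Topology.FourManifolds.LefschetzBaseCoverSectors
import Literature.Topology.FourManifolds.LefschetzBaseCoverOverlap
import HarnessLib

/-!
# The standard Lefschetz base of genus `g`, XII: the overlap of the Milnor cover of the base page

Topic `Literature/Topology/FourManifolds`; namespace `Literature.Topology.FourManifolds.LefschetzBase`.
Companion of `LefschetzBasePageCover.lean` (the traces `pageU g`, `pageV g` on the base page
`page g 1 = {‖x‖² < 4, w = 1/2}` of the Milnor cover `Base g = U ∪ V`, retracted inside the page
through the index maps of `U`, `V`), written so as not to import it (the two traces are spelled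
out; the bookkeeping lemmas of its §13 are repeated as `private` copies).  Here the OVERLAP:

* §16 `(x, y) ↦ (angV · ν (−P_t)^{1/(2g+1)}, angU · √(P_t + 3/2))`, `P_t = −5/16 + t(x^{2g+1} + 5/16)`
  (the interpolation `midP` of `LefschetzBaseCoverOverlap.lean`, now at constant `w = 1/2`),
  deformation retracts `pageU g ∩ pageV g` inside the page onto the `2(2g+1)` points
  `(ν μ^k (5/16)^{1/(2g+1)}, ± √(19/16))`, through the index map `idxW` (sheet sign, sector root)
  of `U ∩ V`: **`homotopyPW : id ≃ secPW ∘ idxW ∘ resPW`**, `idxW_secPW : idxW ∘ resPW ∘ secPW = id`.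
  Hence (downstream, with `homotopyEquivW`) the inclusion `pageU g ∩ pageV g ↪ U ∩ V` is a homology
  isomorphism, the last input of the Mayer–Vietoris comparison `H_*(page g 1) ≅ H_*(Base g)`
  (Milnor 1968, Thm. 9.1: the page is a copy of the Milnor fibre `F_{g,1}` and `Base g ≅ F × D²`).

Everything here is PROVED; nothing is asserted.

## References
* J. Milnor, *Singular points of complex hypersurfaces*, Ann. of Math. Studies 61 (1968), §9,
  Thm. 9.1, Lemma 9.2. [Milnor1968]
* A. Hatcher, *Algebraic Topology*, CUP 2002, §2.2 pp. 149–150 (Mayer–Vietoris). [HatcherAT2002]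
-/

noncomputable section

open scoped Manifold ContDiff Topology
open Set Function Metric
open Literature.Topology.FourManifolds.TorusKnotMilnor

namespace Literature.Topology.FourManifolds

/-- Local notation: `𝔼 n` is the model Euclidean space `EuclideanSpace ℝ (Fin n)`. -/
local notation "𝔼 " n:arg => EuclideanSpace ℝ (Fin n)

namespace LefschetzBase

variable {g : ℕ}

-- Local notation: the overlap `pageU g ∩ pageV g` of `LefschetzBasePageCover.lean`, written out.
set_option quotPrecheck false in
local notation "𝒫𝒲 " g:arg =>
  (({q : ↥(page g 1) | q.1 ∈ coverU g} ∩ {q : ↥(page g 1) | q.1 ∈ coverV g}) : Set ↥(page g 1))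

/-! ## §16a Private copies of the bookkeeping lemmas of `LefschetzBasePageCover.lean` -/

/-- On the base page `y² = x^{2g+1} + 3/2`. [folklore] -/
private theorem cy_sq_of_mem_pageW (q : ↥(page g 1)) : cy q.1.1 ^ 2 = cx q.1.1 ^ (2 * g + 1) + 3 / 2 := by
  have h : w g q.1.1 = 1 / 2 := q.2.2
  rw [w_eq'] at h
  linear_combination h

/-- On the base page `‖x‖^{2g+1} < 2^{2g+1}`. [folklore] -/
private theorem norm_cx_pow_ltW (q : ↥(page g 1)) : ‖cx q.1.1‖ ^ (2 * g + 1) < 2 ^ (2 * g + 1) := by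
  have h : ‖cx q.1.1‖ ^ 2 < 4 := q.2.1
  have h2 : ‖cx q.1.1‖ < 2 := by nlinarith [norm_nonneg (cx q.1.1)]
  exact pow_lt_pow_left₀ h2 (norm_nonneg _) (Nat.succ_ne_zero _)

/-- **Staying in the base**: a point `(a', b')` with `b'² − a'^{2g+1} − 1 = 1/2` and
`‖a'‖^{2g+1} < 2^{2g+1}` has `rho = 1/4`. [folklore] -/
private theorem mk_mem_base_of_pageW {a' b' : ℂ} (hw : b' ^ 2 - a' ^ (2 * g + 1) - 1 = 1 / 2)
    (ha : ‖a'‖ ^ (2 * g + 1) < 2 ^ (2 * g + 1)) : mk a' b' ∈ rho g ⁻¹' Iic (1 / 4 : ℝ) := by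
  have ha2 : ‖a'‖ < 2 := lt_of_pow_lt_pow_left₀ _ (by norm_num) ha
  rw [mem_preimage, mem_Iic, rho_mk', hw, eta_of_le (by nlinarith [norm_nonneg a']),
    show (1 / 2 : ℂ) = ((1 / 2 : ℝ) : ℂ) by push_cast; ring, Complex.norm_real, Real.norm_eq_abs,
    abs_of_pos (by norm_num)]
  norm_num

/-- **Staying in the page**: such a point lies in the base page. [folklore] -/
private theorem mk_mem_pageW {a' b' : ℂ} (hw : b' ^ 2 - a' ^ (2 * g + 1) - 1 = 1 / 2)
    (ha : ‖a'‖ ^ (2 * g + 1) < 2 ^ (2 * g + 1)) :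
    (⟨mk a' b', mk_mem_base_of_pageW hw ha⟩ : Base g) ∈ page g 1 := by
  have ha2 : ‖a'‖ < 2 := lt_of_pow_lt_pow_left₀ _ (by norm_num) ha
  refine ⟨?_, ?_⟩
  · show ‖cx (mk a' b')‖ ^ 2 < 4
    rw [cx_mk]; nlinarith [norm_nonneg a']
  · show w g (mk a' b') = 1 / 2
    rw [w_eq', cx_mk, cy_mk, hw]

/-- `2 ≤ 2^{2g+1}`. [folklore] -/
private theorem two_le_two_powW (g : ℕ) : (2 : ℝ) ≤ 2 ^ (2 * g + 1) := by
  calc (2 : ℝ) = 2 ^ 1 := (pow_one _).symm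
    _ ≤ 2 ^ (2 * g + 1) := pow_le_pow_right₀ (by norm_num) (by omega)

/-! ## §16 The overlap `pageU ∩ pageV` retracts onto `2(2g+1)` points -/

/-- A point of `pageU ∩ pageV`, as a point of `U ∩ V`. [folklore] -/
abbrev pW (q : ↥(𝒫𝒲 g)) : ↥(coverU g ∩ coverV g) := ⟨q.1.1, q.2⟩

/-- **The restriction `pageU g ∩ pageV g → U ∩ V` of the inclusion of the page.** [folklore] -/
def resPW (g : ℕ) : C(↥(𝒫𝒲 g), ↥(coverU g ∩ coverV g)) :=
  ⟨fun q => pW q, (continuous_subtype_val.comp continuous_subtype_val).subtype_mk _⟩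

/-- **The deformation of `pageU ∩ pageV`**: `(x, y) ↦ (angV · ν (−P_t)^{1/(2g+1)}, angU · √(P_t + 3/2))`,
`P_t = midP t = −5/16 + t (x^{2g+1} + 5/16)`. [cite: Milnor1968, §9 Lemma 9.2] -/
def defPW (t : ℝ) (q : ↥(𝒫𝒲 g)) : 𝔼 4 :=
  mk (angV (ovV (pW q)) * (halfRoot (2 * g + 1) * prRoot (2 * g + 1) (-midP t (pW q))))
    (angU (ovU (pW q)) * csqrt (midP t (pW q) + 3 / 2))

/-- Along the deformation `x^{2g+1} = P_t`. [folklore] -/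
theorem defPW_xpow (t : ℝ) (q : ↥(𝒫𝒲 g)) :
    (angV (ovV (pW q)) * (halfRoot (2 * g + 1) * prRoot (2 * g + 1) (-midP t (pW q)))) ^ (2 * g + 1) =
      midP t (pW q) := by
  rw [mul_pow, angV_pow, one_mul, mul_pow, halfRoot_pow (odd_ne_zero g), prRoot_pow (odd_ne_zero g)]; ring

/-- Along the deformation `w = 1/2`. [folklore] -/
theorem defPW_w (t : ℝ) (q : ↥(𝒫𝒲 g)) :
    (angU (ovU (pW q)) * csqrt (midP t (pW q) + 3 / 2)) ^ 2 -
      (angV (ovV (pW q)) * (halfRoot (2 * g + 1) * prRoot (2 * g + 1) (-midP t (pW q)))) ^ (2 * g + 1) -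
        1 = 1 / 2 := by
  rw [defPW_xpow, mul_pow, angU_pow, one_mul, csqrt_sq]; ring

/-- Along the deformation `‖x‖^{2g+1} = ‖P_t‖ < 2^{2g+1}`. [folklore] -/
theorem defPW_xpow_lt {t : ℝ} (ht0 : 0 ≤ t) (ht1 : t ≤ 1) (q : ↥(𝒫𝒲 g)) :
    ‖angV (ovV (pW q)) * (halfRoot (2 * g + 1) * prRoot (2 * g + 1) (-midP t (pW q)))‖ ^ (2 * g + 1) <
      2 ^ (2 * g + 1) := by
  rw [← norm_pow, defPW_xpow]
  exact (norm_midP_le ht0 ht1 (pW q)).trans_lt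
    (max_lt (by linarith [two_le_two_powW g]) (norm_cx_pow_ltW q.1))

/-- Along the deformation the radicand has `Re > 9/8`. [folklore] -/
theorem re_radPW_gt {t : ℝ} (ht0 : 0 ≤ t) (ht1 : t ≤ 1) (q : ↥(𝒫𝒲 g)) :
    9 / 8 < (midP t (pW q) + 3 / 2).re := by
  have h := (re_midP_mem ht0 ht1 (pW q)).1
  rw [Complex.add_re, show ((3 / 2 : ℂ)).re = 3 / 2 by norm_num]
  linarith

/-- The deformation stays in `pageU ∩ pageV` (in the base and in the page by §16a; `Re P_t ∈
(−3/8, −1/4)`). [folklore] -/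
theorem defPW_mem_inter {t : ℝ} (ht0 : 0 ≤ t) (ht1 : t ≤ 1) (q : ↥(𝒫𝒲 g)) :
    (⟨⟨defPW t q, mk_mem_base_of_pageW (defPW_w t q) (defPW_xpow_lt ht0 ht1 q)⟩,
      mk_mem_pageW (defPW_w t q) (defPW_xpow_lt ht0 ht1 q)⟩ : ↥(page g 1)) ∈ 𝒫𝒲 g := by
  have h := re_midP_mem ht0 ht1 (pW q)
  have hP : (cx (defPW t q) ^ (2 * g + 1)).re = (midP t (pW q)).re := by rw [defPW, cx_mk, defPW_xpow]
  exact ⟨show -(3 / 8 : ℝ) < (cx (defPW t q) ^ (2 * g + 1)).re from hP ▸ h.1,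
    show (cx (defPW t q) ^ (2 * g + 1)).re < -(1 / 4 : ℝ) from hP ▸ h.2⟩

/-- The deformation as a map `[0,1] × (pageU ∩ pageV) → pageU ∩ pageV`. [folklore] -/
def defPWMap (z : unitInterval × ↥(𝒫𝒲 g)) : ↥(𝒫𝒲 g) := ⟨_, defPW_mem_inter z.1.2.1 z.1.2.2 z.2⟩

/-- The deformation is continuous. [folklore] -/
theorem continuous_defPWMap : Continuous (defPWMap (g := g)) := by
  refine Continuous.subtype_mk (Continuous.subtype_mk (Continuous.subtype_mk ?_ _) _) _
  have hs : Continuous fun z : unitInterval × ↥(𝒫𝒲 g) => ((z.1 : ℝ) : ℂ) :=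
    Complex.continuous_ofReal.comp (continuous_subtype_val.comp continuous_fst)
  have hq : Continuous fun z : unitInterval × ↥(𝒫𝒲 g) => z.2.1.1.1 :=
    continuous_subtype_val.comp (continuous_subtype_val.comp (continuous_subtype_val.comp continuous_snd))
  have hP : Continuous fun z : unitInterval × ↥(𝒫𝒲 g) => cx z.2.1.1.1 ^ (2 * g + 1) :=
    (contDiff_cx.continuous.comp hq).pow _
  have hmid : Continuous fun z : unitInterval × ↥(𝒫𝒲 g) => midP (z.1 : ℝ) (pW z.2) :=
    continuous_const.add (hs.mul (hP.add continuous_const))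
  have hroot1 : Continuous fun z : unitInterval × ↥(𝒫𝒲 g) =>
      prRoot (2 * g + 1) (-midP (z.1 : ℝ) (pW z.2)) :=
    (continuousOn_prRoot _).comp_continuous hmid.neg fun z => by
      have h := (re_midP_mem z.1.2.1 z.1.2.2 (pW z.2)).2
      show 0 < (-midP (z.1 : ℝ) (pW z.2)).re
      rw [Complex.neg_re]; linarith
  have hroot2 : Continuous fun z : unitInterval × ↥(𝒫𝒲 g) => csqrt (midP (z.1 : ℝ) (pW z.2) + 3 / 2) :=
    continuousOn_csqrt.comp_continuous (hmid.add continuous_const) fun z =>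
      lt_trans (by norm_num) (re_radPW_gt z.1.2.1 z.1.2.2 z.2)
  have hpW : Continuous fun z : unitInterval × ↥(𝒫𝒲 g) => pW z.2 :=
    ((continuous_subtype_val.comp continuous_subtype_val).subtype_mk _).comp continuous_snd
  have hangU : Continuous fun z : unitInterval × ↥(𝒫𝒲 g) => angU (ovU (pW z.2)) :=
    continuous_angU.comp ((continuous_subtype_val.subtype_mk _).comp hpW)
  have hangV : Continuous fun z : unitInterval × ↥(𝒫𝒲 g) => angV (ovV (pW z.2)) :=
    continuous_angV.comp ((continuous_subtype_val.subtype_mk _).comp hpW)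
  exact continuous_mk.comp ((hangV.mul (continuous_const.mul hroot1)).prodMk (hangU.mul hroot2))

/-- At `t = 1`, `P_t = x^{2g+1}` and the deformation is the identity. [folklore] -/
theorem defPW_one (q : ↥(𝒫𝒲 g)) : defPW 1 q = q.1.1.1 := by
  have hmid : midP 1 (pW q) = cx q.1.1.1 ^ (2 * g + 1) := by
    rw [midP, Complex.ofReal_one, one_mul]; show -(5 / 16) + (cx q.1.1.1 ^ (2 * g + 1) + 5 / 16) = _; ring
  have hx : angV (ovV (pW q)) * (halfRoot (2 * g + 1) * prRoot (2 * g + 1) (-cx q.1.1.1 ^ (2 * g + 1))) =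
      cx q.1.1.1 := (cx_eq_angV_mul (ovV (pW q))).symm
  have hy : angU (ovU (pW q)) * csqrt (cy q.1.1.1 ^ 2) = cy q.1.1.1 := (cy_eq_angU_mul (ovU (pW q))).symm
  rw [defPW, hmid, ← cy_sq_of_mem_pageW q.1, hx, hy]
  exact mk_cx_cy q.1.1.1

/-- The base point `(ν μ^k (5/16)^{1/(2g+1)}, μ₂^j √(19/16))` of the overlap: `w = 1/2`. [folklore] -/
theorem basePtPW_w (g j k : ℕ) :
    (rootU 2 ^ j * csqrt (19 / 16)) ^ 2 -
      (halfRoot (2 * g + 1) * rootU (2 * g + 1) ^ k * prRoot (2 * g + 1) (5 / 16)) ^ (2 * g + 1) - 1 =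
        1 / 2 := by
  rw [basePtW_xpow, mul_pow, rootU_pow_pow two_ne_zero, one_mul, csqrt_sq]; norm_num

/-- The base points of the overlap have `‖x‖^{2g+1} = 5/16 < 2^{2g+1}`. [folklore] -/
theorem basePtPW_norm_lt (g k : ℕ) :
    ‖halfRoot (2 * g + 1) * rootU (2 * g + 1) ^ k * prRoot (2 * g + 1) (5 / 16)‖ ^ (2 * g + 1) <
      2 ^ (2 * g + 1) := by
  rw [← norm_pow, basePtW_xpow, norm_neg,
    show (5 / 16 : ℂ) = ((5 / 16 : ℝ) : ℂ) by push_cast; ring, Complex.norm_real, Real.norm_eq_abs,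
    abs_of_pos (by norm_num)]
  linarith [two_le_two_powW g]

/-- The base points of the overlap lie in `pageU ∩ pageV` (`Re x^{2g+1} = −5/16`). [folklore] -/
theorem basePtPW_mem_inter (j k : ℕ) :
    (⟨⟨mk (halfRoot (2 * g + 1) * rootU (2 * g + 1) ^ k * prRoot (2 * g + 1) (5 / 16))
        (rootU 2 ^ j * csqrt (19 / 16)), mk_mem_base_of_pageW (basePtPW_w g j k) (basePtPW_norm_lt g k)⟩,
      mk_mem_pageW (basePtPW_w g j k) (basePtPW_norm_lt g k)⟩ : ↥(page g 1)) ∈ 𝒫𝒲 g := by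
  constructor
  · show -(3 / 8 : ℝ) < (cx (mk _ _) ^ (2 * g + 1)).re
    rw [cx_mk, basePtW_xpow]; norm_num
  · show (cx (mk _ _) ^ (2 * g + 1)).re < -(1 / 4 : ℝ)
    rw [cx_mk, basePtW_xpow]; norm_num

/-- **The section `Fin 2 × Fin (2g+1) → pageU ∩ pageV`.** [folklore] -/
def secPW (g : ℕ) : C(Fin 2 × Fin (2 * g + 1), ↥(𝒫𝒲 g)) :=
  ⟨fun jk => ⟨_, basePtPW_mem_inter (g := g) jk.1 jk.2⟩, continuous_of_discreteTopology⟩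

/-- The sheet sign of the base point `(j, k)` is `μ₂^j`. [folklore] -/
theorem angU_secPW (jk : Fin 2 × Fin (2 * g + 1)) : angU (ovU (pW (secPW g jk))) = rootU 2 ^ (jk.1 : ℕ) := by
  rw [angU]
  show cy (mk _ _) / csqrt (cy (mk _ _) ^ 2) = _
  rw [cy_mk, mul_pow, rootU_pow_pow two_ne_zero, one_mul, csqrt_sq,
    mul_div_cancel_right₀ _ (csqrt_ne_zero (by norm_num))]

/-- The sector root of the base point `(j, k)` is `μ^k`. [folklore] -/
theorem angV_secPW (jk : Fin 2 × Fin (2 * g + 1)) :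
    angV (ovV (pW (secPW g jk))) = rootU (2 * g + 1) ^ (jk.2 : ℕ) := by
  rw [angV]
  show cx (mk _ _) / (halfRoot (2 * g + 1) * prRoot (2 * g + 1) (-(cx (mk _ _) ^ (2 * g + 1)))) = _
  rw [cx_mk, basePtW_xpow, neg_neg, mul_assoc, mul_comm (rootU _ ^ _), ← mul_assoc,
    mul_div_cancel_left₀ _ (mul_ne_zero (halfRoot_ne_zero _) (prRoot_ne_zero (odd_ne_zero g) (by norm_num)))]

/-- `idx ∘ res ∘ sec = id` on `pageU ∩ pageV`. [folklore] -/
theorem idxW_secPW (jk : Fin 2 × Fin (2 * g + 1)) : idxW (resPW g (secPW g jk)) = jk := by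
  show (rootIdx two_ne_zero (angU (ovU (pW (secPW g jk)))),
    rootIdx (odd_ne_zero g) (angV (ovV (pW (secPW g jk))))) = jk
  rw [angU_secPW, angV_secPW, rootIdx_rootU_pow, rootIdx_rootU_pow]

/-- At `t = 0`, `P_t = −5/16` and the deformation is the base point `sec (idx q)`. [folklore] -/
theorem defPW_zero (q : ↥(𝒫𝒲 g)) : defPW 0 q = (secPW g (idxW (resPW g q))).1.1.1 := by
  have hmid : midP 0 (pW q) = -(5 / 16) := by rw [midP, Complex.ofReal_zero, zero_mul, add_zero]
  rw [defPW, hmid, neg_neg, show (-(5 / 16) + 3 / 2 : ℂ) = 19 / 16 by norm_num]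
  show mk (angV (ovV (pW q)) * (halfRoot (2 * g + 1) * prRoot (2 * g + 1) (5 / 16)))
      (angU (ovU (pW q)) * csqrt (19 / 16)) =
    mk (halfRoot (2 * g + 1) * rootU (2 * g + 1) ^ (rootIdx (odd_ne_zero g) (angV (ovV (pW q))) : ℕ) *
        prRoot (2 * g + 1) (5 / 16))
      (rootU 2 ^ (rootIdx two_ne_zero (angU (ovU (pW q))) : ℕ) * csqrt (19 / 16))
  rw [rootU_pow_rootIdx (odd_ne_zero g) (angV_pow _), rootU_pow_rootIdx two_ne_zero (angU_pow _)]
  congr 1; ring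

/-- **The homotopy `id_{pageU ∩ pageV} ≃ sec ∘ idx ∘ res`.** [cite: Milnor1968, §9 Lemma 9.2] -/
def homotopyPW (g : ℕ) : ContinuousMap.Homotopy (ContinuousMap.id ↥(𝒫𝒲 g))
    ((secPW g).comp ((homotopyEquivW g).toFun.comp (resPW g))) where
  toFun z := defPWMap (unitInterval.symm z.1, z.2)
  continuous_toFun := continuous_defPWMap.comp
    ((unitInterval.continuous_symm.comp continuous_fst).prodMk continuous_snd)
  map_zero_left q := by
    apply Subtype.ext; apply Subtype.ext; apply Subtype.ext
    show defPW (unitInterval.symm 0 : ℝ) q = q.1.1.1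
    rw [unitInterval.symm_zero, Set.Icc.coe_one, defPW_one]
  map_one_left q := by
    apply Subtype.ext; apply Subtype.ext; apply Subtype.ext
    show defPW (unitInterval.symm 1 : ℝ) q = (secPW g (idxW (resPW g q))).1.1.1
    rw [unitInterval.symm_one, Set.Icc.coe_zero, defPW_zero]

end LefschetzBase

end Literature.Topology.FourManifolds
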